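import Mathlib
import Literature.NumberTheory.Transcendental.KZProduct
import Literature.NumberTheory.Transcendental.KZCalculusOver
import Summits.KontsevichZagierPeriods.KontsevichZagierPeriods.Theorems.SoloInformedProductOver
import Summits.KontsevichZagierPeriods.KontsevichZagierPeriods.Theorems.SoloInformedProductCommOver
import Summits.KontsevichZagierPeriods.KontsevichZagierPeriods.Theorems.SoloInformedPeriodRingOver
import Summits.KontsevichZagierPeriods.KontsevichZagierPeriods.Theorems.SoloInformedRealScalars
import Summits.KontsevichZagierPeriods.KontsevichZagierPeriods.Theorems.SoloInformedRealDiscTransfer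
import Summits.KontsevichZagierPeriods.KontsevichZagierPeriods.Theorems.SoloInformedRealDiscIdeal
import Summits.KontsevichZagierPeriods.KontsevichZagierPeriods.Theorems.SoloInformedRealParamInjective
import HarnessLib

/-!
# `P_ℝ` is a commutative `ℝ`-algebra, `ev : P_ℝ →ₐ[ℝ] ℝ`, and `Q_ℝ` says `⟦π⟧` is a non-zero-divisor

File of the solo-informed residency (s235), `k = ℝ` sequel of `SoloInformedPeriodRingOver` (the
commutative ring `P_k = KZ_k ⧸ relations k`, here `SoloInformedPeriodRingOver ℝ`).

* Integrand scaling (`SoloInformedRealScalars`) commutes with the Fubini product on the nose: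
  `soloInformed_realScale_mul_left/right`; hence **`P_ℝ` is a commutative `ℝ`-algebra**
  (`SoloInformedPeriodRingOver.instModuleReal` = the residency's `soloInformedRealPeriodModule`,
  `SoloInformedPeriodRingOver.instAlgebraReal`), `algebraMap ℝ P_ℝ c = ⟦[pt, c]⟧`
  (`soloInformed_algebraMap_real_apply`), and **evaluation is an `ℝ`-algebra homomorphism**
  `soloInformedEvalAlgHomReal : P_ℝ →ₐ[ℝ] ℝ`, surjective, so `I := ker ev` is a maximal ideal and
  `P_ℝ = ℝ · 1 ⊕ I` (`soloInformed_ker_evalPOver_real_isMaximal`,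
  `soloInformed_sub_algebraMap_evalPOver_mem_ker`, `soloInformed_algebraMap_mem_ker_evalPOver_iff`).
* `soloInformed_discCyl_eq_prodOver` — the disc cylinder of `SoloInformedRealDiscTransfer` IS the
  Fubini product with `[π]_ℝ = [D̄, 1]`; so `soloInformedDiscMul x = [π]_ℝ * x`
  (`soloInformed_discMul_eq_mul`), `soloInformedDiscMulQuot = (⟦π⟧ * ·)` on `P_ℝ`
  (`soloInformed_discMulQuot_eq_mul`), and **`Q_ℝ` (`SoloInformedPiCancellationReal`) iff `⟦π⟧` is a
  non-zero-divisor of the ring `P_ℝ`** (`soloInformed_piCancellationReal_iff_mem_nonZeroDivisors`);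
  `ev ⟦π⟧ = π`.
* **THEOREM T, ring form** (conditional on the Lion–Rolin preparation fact, as everywhere in the
  residency): the base-change ring homomorphism `P_ℚ →+* P_ℝ` is injective
  (`soloInformed_periodRingBaseChange_rat_real_injective_prep`, from
  `soloInformed_quotientMap_baseChange_injective_prep`).

This is the kernel form of `paper/real-parameters.md` (S1): `P_ℝ` is a commutative `ℝ`-algebra on
which `ev` is an algebra map and `Q_ℝ` is the statement that `⟦π⟧` is a non-zero-divisor.  Nothing
here bears on Conjecture 1 or decides `Q_ℝ` (OPEN).

References: M. Kontsevich, D. Zagier, *Periods* (2001), §1.1 (1), §1.2, §4.1.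
-/

noncomputable section

open Set MeasureTheory
open scoped nonZeroDivisors
open Literature.ModelTheory.ExponentialFields Literature.NumberTheory.Transcendental

namespace Summit.KontsevichZagierPeriods.KontsevichZagierPeriods.Theorems

variable {n m : ℕ}

/-! ### Integrand scaling commutes with the Fubini product -/

/-- `(c • [σ, f]) × [τ, g] = c • ([σ, f] × [τ, g])` as real integral representations. -/
theorem soloInformed_prodOver_realScaleRep_left (c : ℝ) (a : KZOver.IntegralRep ℝ n)
    (b : KZOver.IntegralRep ℝ m) :
    soloInformedProdOver (soloInformedRealScaleRep c a) b =
      soloInformedRealScaleRep c (soloInformedProdOver a b) := by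
  refine KZOver.IntegralRep.ext rfl ?_
  funext z
  simp only [soloInformed_prodOver_integrand, soloInformed_prodFunOver_apply,
    soloInformed_realScaleRep_integrand]
  ring

/-- `[σ, f] × (c • [τ, g]) = c • ([σ, f] × [τ, g])` as real integral representations. -/
theorem soloInformed_prodOver_realScaleRep_right (c : ℝ) (a : KZOver.IntegralRep ℝ n)
    (b : KZOver.IntegralRep ℝ m) :
    soloInformedProdOver a (soloInformedRealScaleRep c b) =
      soloInformedRealScaleRep c (soloInformedProdOver a b) := by
  refine KZOver.IntegralRep.ext rfl ?_
  funext z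
  simp only [soloInformed_prodOver_integrand, soloInformed_prodFunOver_apply,
    soloInformed_realScaleRep_integrand]
  ring

/-- **`(c • x) * y = c • (x * y)` in `KZ_ℝ`** (an equality of formal combinations). -/
theorem soloInformed_realScale_mul_left (c : ℝ) (x y : KZOver.FormalRep ℝ) :
    soloInformedRealScale c x * y = soloInformedRealScale c (x * y) := by
  refine soloInformed_formalRepOver_mul_induction
    (p := fun x y => soloInformedRealScale c x * y = soloInformedRealScale c (x * y))
    ?_ ?_ ?_ ?_ ?_ ?_ ?_ x y
  · intro n m r s
    rw [soloInformed_realScale_of, soloInformed_ofOver_mul_ofOver, soloInformed_ofOver_mul_ofOver,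
      soloInformed_realScale_of, soloInformed_prodOver_realScaleRep_left]
  · intro d; simp only [map_zero, zero_mul]
  · intro c'; simp only [mul_zero, map_zero]
  · intro c' d h; rw [map_neg, neg_mul, h, neg_mul, map_neg]
  · intro c' d h; rw [mul_neg, h, mul_neg, map_neg]
  · intro c₁ c₂ d h₁ h₂; rw [map_add, add_mul, h₁, h₂, add_mul, map_add]
  · intro c' d₁ d₂ h₁ h₂; rw [mul_add, h₁, h₂, mul_add, map_add]

/-- **`x * (c • y) = c • (x * y)` in `KZ_ℝ`** (an equality of formal combinations). -/
theorem soloInformed_realScale_mul_right (c : ℝ) (x y : KZOver.FormalRep ℝ) :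
    x * soloInformedRealScale c y = soloInformedRealScale c (x * y) := by
  refine soloInformed_formalRepOver_mul_induction
    (p := fun x y => x * soloInformedRealScale c y = soloInformedRealScale c (x * y))
    ?_ ?_ ?_ ?_ ?_ ?_ ?_ x y
  · intro n m r s
    rw [soloInformed_realScale_of, soloInformed_ofOver_mul_ofOver, soloInformed_ofOver_mul_ofOver,
      soloInformed_realScale_of, soloInformed_prodOver_realScaleRep_right]
  · intro d; simp only [zero_mul, map_zero]
  · intro c'; simp only [map_zero, mul_zero]
  · intro c' d h; rw [neg_mul, h, neg_mul, map_neg]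
  · intro c' d h; rw [map_neg, mul_neg, h, mul_neg, map_neg]
  · intro c₁ c₂ d h₁ h₂; rw [add_mul, h₁, h₂, add_mul, map_add]
  · intro c' d₁ d₂ h₁ h₂; rw [map_add, mul_add, h₁, h₂, mul_add, map_add]

/-! ### The commutative `ℝ`-algebra `P_ℝ` -/

/-- **Real scalars on `P_ℝ`**: the residency's `ℝ`-module structure `soloInformedRealPeriodModule`
(integrand scaling, `SoloInformedRealScalars`) on the ring `SoloInformedPeriodRingOver ℝ` (the same
type and additive group). -/
instance SoloInformedPeriodRingOver.instModuleReal : Module ℝ (SoloInformedPeriodRingOver ℝ) :=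
  soloInformedRealPeriodModule

/-- `c • ⟦x⟧ = ⟦c • x⟧` in `P_ℝ`. -/
theorem soloInformed_real_smul_toPeriodOver (c : ℝ) (x : KZOver.FormalRep ℝ) :
    c • soloInformedToPeriodOver ℝ x = soloInformedToPeriodOver ℝ (soloInformedRealScale c x) := rfl

/-- **`P_ℝ` is a commutative `ℝ`-algebra**: real scalars commute with the product on both sides
(`soloInformed_realScale_mul_left/right`). -/
instance SoloInformedPeriodRingOver.instAlgebraReal : Algebra ℝ (SoloInformedPeriodRingOver ℝ) :=
  Algebra.ofModule
    (fun c x y => by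
      obtain ⟨a, rfl⟩ := soloInformed_toPeriodOver_surjective ℝ x
      obtain ⟨b, rfl⟩ := soloInformed_toPeriodOver_surjective ℝ y
      rw [soloInformed_real_smul_toPeriodOver, ← map_mul, ← map_mul,
        soloInformed_real_smul_toPeriodOver, soloInformed_realScale_mul_left])
    (fun c x y => by
      obtain ⟨a, rfl⟩ := soloInformed_toPeriodOver_surjective ℝ x
      obtain ⟨b, rfl⟩ := soloInformed_toPeriodOver_surjective ℝ y
      rw [soloInformed_real_smul_toPeriodOver, ← map_mul, ← map_mul,
        soloInformed_real_smul_toPeriodOver, soloInformed_realScale_mul_right])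

/-- **`algebraMap ℝ P_ℝ c = ⟦[pt, c]⟧`** (`= c • ⟦[pt, 1]⟧`). -/
theorem soloInformed_algebraMap_real_apply (c : ℝ) :
    algebraMap ℝ (SoloInformedPeriodRingOver ℝ) c =
      soloInformedToPeriodOver ℝ (KZOver.of (soloInformedRealScaleRep c soloInformedUnitOver)) := by
  rw [Algebra.algebraMap_eq_smul_one, ← soloInformed_toPeriodOver_of_unitOver,
    soloInformed_real_smul_toPeriodOver, soloInformed_realScale_of]

/-- **`ev (c • x) = c · ev x`** on `P_ℝ`. -/
theorem soloInformed_evalPOver_real_smul (c : ℝ) (x : SoloInformedPeriodRingOver ℝ) :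
    soloInformedEvalPOver ℝ (c • x) = c * soloInformedEvalPOver ℝ x := by
  obtain ⟨a, rfl⟩ := soloInformed_toPeriodOver_surjective ℝ x
  rw [soloInformed_real_smul_toPeriodOver, soloInformed_evalPOver_toPeriodOver,
    soloInformed_evalPOver_toPeriodOver, soloInformed_eval_realScale]

/-- **Evaluation is an `ℝ`-algebra homomorphism `P_ℝ →ₐ[ℝ] ℝ`.** -/
def soloInformedEvalAlgHomReal : SoloInformedPeriodRingOver ℝ →ₐ[ℝ] ℝ :=
  AlgHom.mk' (soloInformedEvalPOver ℝ) fun c x => by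
    rw [soloInformed_evalPOver_real_smul, smul_eq_mul]

/-- The algebra homomorphism is `soloInformedEvalPOver ℝ` as a function. -/
@[simp] theorem soloInformed_evalAlgHomReal_apply (x : SoloInformedPeriodRingOver ℝ) :
    soloInformedEvalAlgHomReal x = soloInformedEvalPOver ℝ x := rfl

/-- `ev (algebraMap c) = c`: the structure map of `P_ℝ` is injective and `ev` is surjective. -/
theorem soloInformed_evalPOver_algebraMap (c : ℝ) :
    soloInformedEvalPOver ℝ (algebraMap ℝ (SoloInformedPeriodRingOver ℝ) c) = c := by
  rw [Algebra.algebraMap_eq_smul_one, soloInformed_evalPOver_real_smul, map_one, mul_one]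

/-- **`ev : P_ℝ → ℝ` is surjective** (already on scalars `⟦[pt, c]⟧`). -/
theorem soloInformed_evalPOver_real_surjective : Function.Surjective (soloInformedEvalPOver ℝ) :=
  fun c => ⟨algebraMap ℝ (SoloInformedPeriodRingOver ℝ) c, soloInformed_evalPOver_algebraMap c⟩

/-- **`I := ker ev` is a maximal ideal of `P_ℝ`** (`P_ℝ ⧸ I ≃ ℝ`, a field). -/
theorem soloInformed_ker_evalPOver_real_isMaximal :
    (RingHom.ker (soloInformedEvalPOver ℝ)).IsMaximal :=
  RingHom.ker_isMaximal_of_surjective _ soloInformed_evalPOver_real_surjective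

/-- **`P_ℝ = ℝ · 1 + I`**: every real formal period is its value (a scalar) plus an element of
`I = ker ev`. -/
theorem soloInformed_sub_algebraMap_evalPOver_mem_ker (x : SoloInformedPeriodRingOver ℝ) :
    x - algebraMap ℝ (SoloInformedPeriodRingOver ℝ) (soloInformedEvalPOver ℝ x) ∈
      RingHom.ker (soloInformedEvalPOver ℝ) := by
  rw [RingHom.mem_ker, map_sub, soloInformed_evalPOver_algebraMap, sub_self]

/-- **`ℝ · 1 ∩ I = 0`**: a scalar in `ker ev` is `0`. -/
theorem soloInformed_algebraMap_mem_ker_evalPOver_iff (c : ℝ) :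
    algebraMap ℝ (SoloInformedPeriodRingOver ℝ) c ∈ RingHom.ker (soloInformedEvalPOver ℝ) ↔ c = 0 := by
  rw [RingHom.mem_ker, soloInformed_evalPOver_algebraMap]

/-! ### `⟦π⟧` and `Q_ℝ` in the ring `P_ℝ` -/

/-- **The disc cylinder is the Fubini product with `[π]_ℝ = [D̄, 1]`**:
`D̄ × [τ, g] = [D̄, 1] × [τ, g]` as real integral representations. -/
theorem soloInformed_discCyl_eq_prodOver (s : KZOver.IntegralRep ℝ m) :
    soloInformedDiscCyl s = soloInformedProdOver (KZOver.IntegralRep.ofKZOver ℝ KZ.piRep) s := by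
  refine KZOver.IntegralRep.ext ?_ ?_
  · ext z
    simp
  · funext z
    simp [soloInformed_prodFunOver_apply]

/-- **`[π] · x = [π]_ℝ * x`**: the residency's `soloInformedDiscMul` is left multiplication by the
real disc representation in the ring `KZ_ℝ`. -/
theorem soloInformed_discMul_eq_mul (x : KZOver.FormalRep ℝ) :
    soloInformedDiscMul x = KZOver.of (KZOver.IntegralRep.ofKZOver ℝ KZ.piRep) * x := by
  induction x using FreeAbelianGroup.induction_on with
  | zero => rw [map_zero, mul_zero]
  | of X =>
    obtain ⟨m, s⟩ := X
    exact (soloInformed_discMul_of s).trans ((congrArg KZOver.of (soloInformed_discCyl_eq_prodOver s)).trans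
      (soloInformed_ofOver_mul_ofOver _ s).symm)
  | neg X ih => rw [map_neg, mul_neg, ih]
  | add X Y hX hY => rw [map_add, mul_add, hX, hY]

/-- **`⟦π⟧ ∈ P_ℝ`**, the class of the real disc representation `[D̄, 1]`. -/
def soloInformedPiClassReal : SoloInformedPeriodRingOver ℝ :=
  soloInformedToPeriodOver ℝ (KZOver.of (KZOver.IntegralRep.ofKZOver ℝ KZ.piRep))

/-- `ev ⟦π⟧ = π`. -/
theorem soloInformed_evalPOver_piClassReal :
    soloInformedEvalPOver ℝ soloInformedPiClassReal = Real.pi := by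
  rw [soloInformedPiClassReal, soloInformed_evalPOver_toPeriodOver_of]
  exact KZ.piRep_value

/-- **`[π] ·` on `P_ℝ` is multiplication by `⟦π⟧`**: `soloInformedDiscMulQuot x = ⟦π⟧ * x`. -/
theorem soloInformed_discMulQuot_eq_mul (x : SoloInformedPeriodRingOver ℝ) :
    soloInformedDiscMulQuot x = soloInformedPiClassReal * x := by
  obtain ⟨c, rfl⟩ := soloInformed_toPeriodOver_surjective ℝ x
  change soloInformedToPeriodOver ℝ (soloInformedDiscMul c) =
    soloInformedToPeriodOver ℝ (KZOver.of (KZOver.IntegralRep.ofKZOver ℝ KZ.piRep) * c)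
  rw [soloInformed_discMul_eq_mul]

/-- `⟦π⟧ * ⟦c⟧ = ⟦[π] · c⟧`. -/
theorem soloInformed_piClassReal_mul_toPeriodOver (c : KZOver.FormalRep ℝ) :
    soloInformedPiClassReal * soloInformedToPeriodOver ℝ c =
      soloInformedToPeriodOver ℝ (soloInformedDiscMul c) := by
  rw [soloInformedPiClassReal, ← map_mul, soloInformed_discMul_eq_mul]

/-- **`Q_ℝ` iff `⟦π⟧ * x = 0 → x = 0` on `P_ℝ`.** -/
theorem soloInformed_piCancellationReal_iff_forall_mul_eq_zero :
    SoloInformedPiCancellationReal ↔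
      ∀ x : SoloInformedPeriodRingOver ℝ, soloInformedPiClassReal * x = 0 → x = 0 := by
  constructor
  · intro h x hx
    obtain ⟨c, rfl⟩ := soloInformed_toPeriodOver_surjective ℝ x
    rw [soloInformed_piClassReal_mul_toPeriodOver, soloInformed_toPeriodOver_eq_zero_iff] at hx
    exact soloInformed_toPeriodOver_eq_zero_iff.mpr (h c hx)
  · intro h c hc
    have h1 : soloInformedPiClassReal * soloInformedToPeriodOver ℝ c = 0 := by
      rw [soloInformed_piClassReal_mul_toPeriodOver, soloInformed_toPeriodOver_eq_zero_iff]
      exact hc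
    exact soloInformed_toPeriodOver_eq_zero_iff.mp (h _ h1)

/-- **`Q_ℝ` iff `⟦π⟧` is a non-zero-divisor of the ring `P_ℝ`.** The residency's open statement
`SoloInformedPiCancellationReal` (`[π] · c ∈ relations ℝ → c ∈ relations ℝ`) is exactly
`⟦π⟧ ∈ (P_ℝ)⁰`.  Nothing is asserted about either side (OPEN). -/
theorem soloInformed_piCancellationReal_iff_mem_nonZeroDivisors :
    SoloInformedPiCancellationReal ↔
      soloInformedPiClassReal ∈ nonZeroDivisors (SoloInformedPeriodRingOver ℝ) := by
  rw [soloInformed_piCancellationReal_iff_forall_mul_eq_zero, mem_nonZeroDivisors_iff_left]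

/-! ### THEOREM T in ring form -/

/-- **`P_ℚ →+* P_ℝ` is an injective ring homomorphism**, conditional on the preparation fact: the
base-change ring map of `SoloInformedPeriodRingOver` is, on the additive quotients, the map of
`soloInformed_quotientMap_baseChange_injective_prep` (THEOREM T of the residency). -/
theorem soloInformed_periodRingBaseChange_rat_real_injective_prep (hprep : semialgebraicPreparation) :
    Function.Injective (soloInformedPeriodRingBaseChange ℚ ℝ) := by
  intro x y h
  apply soloInformed_quotientMap_baseChange_injective_prep hprep
  rw [← soloInformed_periodRingBaseChange_eq_map, ← soloInformed_periodRingBaseChange_eq_map]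
  exact h

end Summit.KontsevichZagierPeriods.KontsevichZagierPeriods.Theorems
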